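import Summits.QuantumFields.YangMills.Theorems.BalabanUVNodesPortZDFirstLevel
import Literature.MathematicalPhysics.QuantumFieldTheory.Balaban1983to89.Node00.CanonicalTransportOfRecord

/-!
# NODE O port, row PT-A′ helper lane (PTZ-1, gen 2): LOCALITY OVER THE BASE of the transport of record — two densities that agree over
# an open set `U` of coarse fields (i.e. on `avg⁻¹ U`) have the same disintegration transform almost everywhere on `U` and the same CANONICAL
# VERSION at every point of `U ∩ regSet` — and the FIBRE-WISE first-level identity `𝓝_1 = 𝓝⁰_1` it yields

[Balaban1987RG1] = [I] (CMP 109, 1987): (0.13) p. 254 (the renormalisation transformation integrates over the fibre `{U : Ū = V}` — the δ-functions),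
(0.17) ∕ (0.19) p. 255, (0.21) p. 256, (1.2) p. 260, (2.9) p. 266 with the rider p. 266–267; [Balaban1988Convergent] = [III] (3.1) p. 264.

Seat `ymgap-nodeO-port-PTZ-1` g2 (prover, HELPER MODE; `--supports stmt-QuantumFields-27930 --as helper`).  GENERIC over densities `ρ₁ ρ₂ ∕ χ ∕ A₁ A₂`; the
transport is THE TREE'S transport of record (`Node00.transportOfRecord` = the disintegration-kernel transform along `avOfRecord`, and its canonical version
`Node00.TcanOfRecord = TβOfRecord₁₃`), so every row is selection-FREE (no cut-off of record, no `Uk`-value is read except through gen 2's `Uk_succ_mem_bgReg`).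

WHY (the located residue of gen 2's PORT-PLAN v2 §3, made into displayed hypotheses of recognised species).  The `k = 0` instance of the history-channel clause
(L) of `PortZeroInputSplitZD` (26648) at the record is GERM-conditional (`PortZDRecord.formatPlusG_channel_zero_of_germ`): the germ «`𝓝_1(W_B) = 𝓝⁰_1(W_B)`
near `B = 0`» needs (h₁) «the level-0 cut-off is supported in the regularity class» — which for the PRINTED (2.9) species holds only ON THE FIBRES over regular
coarse fields (the `b₀(c)`-variables are restricted by the averaging constraint, rider p. 266–267), never globally.  A fibre-wise (h₁) reaches the transform only
through TWO facts about the transport, both proved here from the tree's disintegration (`T4AveragingDisintegration.condLaw_fibre_ae`: the conditional law lives on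
the fibre for almost every coarse field; `withDensity_margDensity`: where it might not, the marginal density — a factor of the transform — vanishes) and from K0e's
canonical-version calculus (`Node00.canonVersion_eqOn_of_continuousOn`: pointwise determinacy on every open set carrying a continuous representative):
* §1 ★ `transportOfRecord_congr_ae` — `ρ₁ = ρ₂` on `avg⁻¹ U` ⟹ `transportOfRecord ρ₁ = transportOfRecord ρ₂` for a.e. coarse field in `U`;
  ★★ `TcanOfRecord_eqOn_of_eqOn_preimage` — for `U` OPEN: the canonical versions AGREE AT EVERY POINT of `U ∩ regSetOfRecord ρ₁`, and that set lies in
  `regSetOfRecord ρ₂` (so the statement is symmetric); `nextAction_TcanOfRecord_congr` — one step (0.19) `𝐓_k(A₁)(W) = 𝐓_k(A₂)(W)` whenever `A₁ = A₂` on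
  `supp χ_k ∩ avg⁻¹ U` and both `W` and the normalising point `1` lie in `U ∩ regSet`.
* §2 ★★ `dChannel_zero_at_first_level_fibrewise` — `𝓝_1(W) = 𝓝⁰_1(W)` at every `W ∈ U` for ANY cut-off family `χ` over the canonical transport, from the
  FIBRE-WISE support hypothesis `∀ V, V̄ ∈ U → χ_0(V) ≠ 0 → V ∈ bgReg_0(ε)` (the honest form of (h₁) for the printed species: rider on the fibres over `U`), the
  DETERMINACY hypothesis `U ⊆ regSetOfRecord K 0 (χ_0 e^{−GF∕g_0² + A_0})` with `1 ∈ U` (node00 K0e's located-open species (F1)–(F3): «how large is `regSet`»), and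
  `0 < ε`, `0 < K`; (h₂) is gen 2's `PortZD.Uk_succ_mem_bgReg`.  The record instance (χ := `chiβOfRecord₁₃Ax θfill`, the germ in `B` through the continuous chart
  `W_B`) is the companion file `…PortZDRecordChannelFibre`.
HONEST FRAMING.  Soft measure theory over the tree's disintegration + definition chasing; NOTHING of Bałaban's estimates asserted, ported or discharged; the two
displayed hypotheses of §2 (fibre-wise rider, determinacy near `W = 1`) are NOT discharged here — they are print's p. 266–267 rider resp. the continuity of the
transform on the small-field domain, both outside this helper's lane; 26648 ∕ 27930⁸ SIGNED·OPEN (content-gated), 27931 under CLOSE HOLD, 27932 CLOSED; counts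
unmoved; finite 𝕋⁴ at fixed ε — NOT continuum ∕ OS ∕ Clay; the Yang–Mills mass gap is NOT proved by any of this.  No `sorry` ∕ `def` ∕ `instance` ∕ `notation`.
-/

noncomputable section

open MeasureTheory Set Filter
open scoped ENNReal NNReal Topology

namespace Summit.QuantumFields.YangMills.Theorems.PortZD

open Literature.MathematicalPhysics.QuantumFieldTheory.Balaban1983to89
open Literature.MathematicalPhysics.QuantumFieldTheory.Balaban1983to89.Node00
open Literature.MathematicalPhysics.QuantumFieldTheory.Balaban1983to89.T4Continuum (T4Family)
open T4AveragingDisintegration (kernelTransport margDensity condLaw condLaw_fibre_ae withDensity_margDensity measurable_margDensity)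
open B12Eq019ActionBody (nextAction nextAction_apply normConst normConst_def integrand)

variable {F : T4Family} {N : ℕ} [NeZero N]

/-! ## §1. Locality over the base: a.e. for the disintegration transform, pointwise on `regSet` for its canonical version -/

/-- ★ **THE DISINTEGRATION TRANSFORM IS LOCAL OVER THE BASE**: if two densities of the fine field agree on `avg⁻¹ U` (`U` any set of coarse fields), their
transforms `transportOfRecord` agree at almost every coarse field in `U` — the conditional law `condLaw(V, ·)` gives full mass to the fibre `{Ū = V}` for
`(avg_* dU)`-a.e. `V`, i.e. for `dV`-a.e. `V` off the zero set of the marginal density, which is a factor of the transform. [cite: Balaban1987RG1, (0.13) p.254; Balaban1988Convergent, (3.1) p.264] -/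
theorem transportOfRecord_congr_ae (K k : ℕ) (hk : k < K) {U : Set (GaugeField (F.P K) (k + 1) (SU N))}
    {ρ₁ ρ₂ : Density (F.P K) k (SU N)} (h : ∀ V, (avOfRecord F N K k).avg V ∈ U → ρ₁ V = ρ₂ V) :
    ∀ᵐ W ∂(fieldMeasure (F.P K) (k + 1) (SU N)), W ∈ U → transportOfRecord F N K k ρ₁ W = transportOfRecord F N K k ρ₂ W := by
  have havg := avOfRecord_measurable F N K k
  have hac : (fieldMeasure (F.P K) k (SU N)).map (avOfRecord F N K k).avg ≪ fieldMeasure (F.P K) (k + 1) (SU N) :=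
    avOfRecord_haarAC F N K k hk
  have hfib := condLaw_fibre_ae (fieldMeasure (F.P K) k (SU N)) havg
  rw [← withDensity_margDensity (fieldMeasure (F.P K) k (SU N)) (fieldMeasure (F.P K) (k + 1) (SU N)) havg hac,
    ae_withDensity_iff measurable_margDensity.coe_nnreal_ennreal] at hfib
  filter_upwards [hfib] with W hW hWU
  show kernelTransport _ _ _ ρ₁ W = kernelTransport _ _ _ ρ₂ W
  unfold kernelTransport
  by_cases h0 : margDensity (fieldMeasure (F.P K) k (SU N)) (fieldMeasure (F.P K) (k + 1) (SU N)) (avOfRecord F N K k).avg W = 0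
  · rw [h0, NNReal.coe_zero, zero_mul, zero_mul]
  · have h1 := hW (by exact_mod_cast h0)
    congr 1
    apply integral_congr_ae
    have hmem : {V | (avOfRecord F N K k).avg V = W} ∈ ae (condLaw (fieldMeasure (F.P K) k (SU N)) (avOfRecord F N K k).avg W) := by
      rw [mem_ae_iff]
      exact (prob_compl_eq_zero_iff (measurableSet_eq_fun havg measurable_const)).2 h1
    filter_upwards [hmem] with V hV
    exact h V (by rw [show (avOfRecord F N K k).avg V = W from hV]; exact hWU)

/-- ★★ **POINTWISE LOCALITY OF THE CANONICAL VERSION** (`TβOfRecord₁₃ = TcanOfRecord`): for `U` OPEN and `ρ₁ = ρ₂` on `avg⁻¹ U`, the canonical transports AGREE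
AT EVERY POINT of `U ∩ regSetOfRecord ρ₁`, and `U ∩ regSetOfRecord ρ₁ ⊆ regSetOfRecord ρ₂` (determinacy on open sets carrying a continuous representative: there
`TcanOfRecord ρ₁` is one for `transportOfRecord ρ₂`). [cite: Balaban1987RG1, (0.13) p.254 and (0.19) p.255 (bookkeeping)] -/
theorem TcanOfRecord_eqOn_of_eqOn_preimage {K k : ℕ} (hk : k < K) {U : Set (PBond (F.P K) (k + 1) → SU N)} (hUo : IsOpen U)
    {ρ₁ ρ₂ : Density (F.P K) k (SU N)} (h : ∀ V, (avOfRecord F N K k).avg V ∈ U → ρ₁ V = ρ₂ V) :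
    EqOn (TcanOfRecord F N K k ρ₂) (TcanOfRecord F N K k ρ₁) (U ∩ regSetOfRecord F N K k ρ₁) ∧
      U ∩ regSetOfRecord F N K k ρ₁ ⊆ regSetOfRecord F N K k ρ₂ := by
  have hO : IsOpen (U ∩ regSetOfRecord F N K k ρ₁) := hUo.inter (isOpen_regSetOfRecord K k ρ₁)
  have hg : ContinuousOn (fun V : PBond (F.P K) (k + 1) → SU N => TcanOfRecord F N K k ρ₁ V) (U ∩ regSetOfRecord F N K k ρ₁) :=
    (continuousOn_TcanOfRecord K k ρ₁).mono inter_subset_right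
  have hae1 : (fun V : PBond (F.P K) (k + 1) → SU N => TcanOfRecord F N K k ρ₁ V)
      =ᵐ[(piHaar (F.P K) (k + 1) (SU N)).restrict (U ∩ regSetOfRecord F N K k ρ₁)] fun V => transportOfRecord F N K k ρ₁ V :=
    ae_restrict_of_ae (TcanOfRecord_ae_eq K k ρ₁)
  have hae12 : (fun V : PBond (F.P K) (k + 1) → SU N => transportOfRecord F N K k ρ₁ V)
      =ᵐ[(piHaar (F.P K) (k + 1) (SU N)).restrict (U ∩ regSetOfRecord F N K k ρ₁)] fun V => transportOfRecord F N K k ρ₂ V := by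
    have hU := transportOfRecord_congr_ae K k hk (U := U) h
    rw [Filter.EventuallyEq, ae_restrict_iff' hO.measurableSet]
    filter_upwards [hU] with W hW hWO
    exact hW hWO.1
  have hae := hae1.trans hae12
  exact ⟨TcanOfRecord_eqOn_of_continuousOn hO hg hae, subset_regSetOfRecord_of_hasContTransportOn hO ⟨_, hg, hae⟩⟩

/-- **ONE STEP OF (0.19) IS LOCAL OVER THE BASE, POINTWISE ON `regSet`**: if the input actions `A₁`, `A₂` agree on `supp χ ∩ avg⁻¹ U` (`U` open), then
`𝐓(A₁)(W) = 𝐓(A₂)(W)` over the canonical transport of record at every `W ∈ U ∩ regSet(χ e^{−GF∕g² + A₁})`, provided the normalising point `1` lies there too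
(`𝐍 = T(…)(1)`). [cite: Balaban1987RG1, (0.19) p.255 (bookkeeping)] -/
theorem nextAction_TcanOfRecord_congr {K k : ℕ} (hk : k < K) {χ GF A₁ A₂ : Density (F.P K) k (SU N)} {gk : ℝ}
    {U : Set (PBond (F.P K) (k + 1) → SU N)} (hUo : IsOpen U)
    (h : ∀ V, (avOfRecord F N K k).avg V ∈ U → χ V ≠ 0 → A₁ V = A₂ V) {W : GaugeField (F.P K) (k + 1) (SU N)}
    (hW : W ∈ U ∩ regSetOfRecord F N K k (integrand χ GF gk A₁))
    (h1 : (1 : GaugeField (F.P K) (k + 1) (SU N)) ∈ U ∩ regSetOfRecord F N K k (integrand χ GF gk A₁)) :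
    nextAction (TcanOfRecord F N K k) χ GF gk A₁ W = nextAction (TcanOfRecord F N K k) χ GF gk A₂ W := by
  have hint : ∀ V, (avOfRecord F N K k).avg V ∈ U → integrand χ GF gk A₁ V = integrand χ GF gk A₂ V := by
    intro V hV
    by_cases hχ : χ V = 0
    · simp [integrand, hχ]
    · simp [integrand, h V hV hχ]
  have hE := (TcanOfRecord_eqOn_of_eqOn_preimage hk hUo hint).1
  rw [nextAction_apply, nextAction_apply, normConst_def, normConst_def, hE h1, hE hW]

/-! ## §2. The first-level identity from the FIBRE-WISE support hypothesis, over the canonical transport -/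

/-- ★★ **`𝓝_1(W) = 𝓝⁰_1(W)` ON AN OPEN SET OF COARSE FIELDS, FROM (h₁) ON THE FIBRES** — any cut-off family `χ`, the canonical transport of record, radius
`0 < ε`, `0 < K`: if (rider, fibre-wise) every fine field in `supp χ_0` whose one-step average lies in `U` is regular, `V ∈ bgReg_0(ε)`, and (determinacy) `U` —
containing the normalising point `1` — lies in the maximal regular set of the transform of the level-0 density `χ_0 e^{−GF_0∕g_0² + A_0}`, then for EVERY `W ∈ U`
the history channel vanishes: `𝓝_1(W) − 𝓝⁰_1(W) = [𝐓_0(A_0) − 𝐓_0(A⁰_0)](W) − 𝐄_0(U_1 W) = 0` (`A_0 = A⁰_0` on `supp χ_0 ∩ avg⁻¹ U` by (0.21) at k = 0,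
§1's `nextAction_TcanOfRecord_congr`; `𝐄_0(U_1 W) = 0` since `U_1(W) ∈ bgReg_0`, gen 2's `Uk_succ_mem_bgReg`). [cite: Balaban1987RG1, (0.17) p.255, (0.21) p.256, (2.9) p.266–267] -/
theorem dChannel_zero_at_first_level_fibrewise (χ : (K : ℕ) → (ℕ → ℝ) → (k : ℕ) → Density (F.P K) k (SU N)) {ε : ℝ} (hε : 0 < ε)
    {K : ℕ} (hK : 0 < K) (g : ℕ → ℝ) {U : Set (PBond (F.P K) 1 → SU N)} (hUo : IsOpen U)
    (hχU : ∀ V : GaugeField (F.P K) 0 (SU N), (avOfRecord F N K 0).avg V ∈ U → χ K g 0 V ≠ 0 → V ∈ bgReg F N K 0 ε)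
    (hreg : U ⊆ regSetOfRecord F N K 0
      (integrand (χ K g 0) (gfOfRecord F N K 0) (g 0) (effActionHT F N (TcanOfRecord F N) χ K g 0)))
    (h1 : (1 : GaugeField (F.P K) 1 (SU N)) ∈ U) {W : GaugeField (F.P K) 1 (SU N)} (hW : W ∈ U) :
    mergedTermT F N (TcanOfRecord F N) χ ε K g 0 W = ZeroInput.zeroInputMergedTermT F N (TcanOfRecord F N) χ ε K g 0 W := by
  have hD := ZeroInput.dChannel_eq F N (TcanOfRecord F N) χ ε K g 0 W
  have hU1 : Uk F N K 0 ε (Averaging.iter (avOfRecord F N K) 0 (Uk F N K 1 ε W)) = Averaging.iter (avOfRecord F N K) 0 (Uk F N K 1 ε W) :=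
    B11Thm1LevelZero.Uk_zero_eq (Uk_succ_mem_bgReg K 0 hε W)
  have hE := ZeroInput.EkT_zero_of_Uk_id F N (TcanOfRecord F N) χ ε K g _ hU1
  have hA : nextAction (TcanOfRecord F N K 0) (χ K g 0) (gfOfRecord F N K 0) (g 0) (effActionHT F N (TcanOfRecord F N) χ K g 0) W =
      nextAction (TcanOfRecord F N K 0) (χ K g 0) (gfOfRecord F N K 0) (g 0) (ZeroInput.mainTermT F N ε K g 0) W :=
    nextAction_TcanOfRecord_congr hK hUo
      (fun V hV hχ => (ZeroInput.mainTermT_zero_of_Uk_id F N (TcanOfRecord F N) χ ε K g V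
        (B11Thm1LevelZero.Uk_zero_eq (hχU V hV hχ))).symm)
      ⟨hW, hreg hW⟩ ⟨h1, hreg h1⟩
  rw [hA, hE, sub_self, sub_zero] at hD
  linarith

/-- The same for a COUPLING-BLIND cut-off family (every (2.9)-keyed species): the fibre-wise support hypothesis at ONE history serves every history with the same
`g 0` … stated simply per history `g`, matrix-carrier form at `k = 0` (every history `v : Fin 1 → ℝ`, every matrix field whose `SU(N)`-reading lies in `U`).
[cite: Balaban1987RG1, (0.17) p.255, (1.20) p.264 (bookkeeping)] -/
theorem mergedTermFamilyMatT_zero_eq_fibrewise (χ : (K : ℕ) → (ℕ → ℝ) → (k : ℕ) → Density (F.P K) k (SU N)) {ε : ℝ} (hε : 0 < ε)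
    {K : ℕ} (hK : 0 < K) (v : Fin 1 → ℝ) {U : Set (PBond (F.P K) 1 → SU N)} (hUo : IsOpen U)
    (hχU : ∀ V : GaugeField (F.P K) 0 (SU N), (avOfRecord F N K 0).avg V ∈ U → χ K (T4FlagMemory.extd v) 0 V ≠ 0 → V ∈ bgReg F N K 0 ε)
    (hreg : U ⊆ regSetOfRecord F N K 0
      (integrand (χ K (T4FlagMemory.extd v) 0) (gfOfRecord F N K 0) (T4FlagMemory.extd v 0)
        (effActionHT F N (TcanOfRecord F N) χ K (T4FlagMemory.extd v) 0)))
    (h1 : (1 : GaugeField (F.P K) 1 (SU N)) ∈ U) {W : Fin (F.P K).d → Site (F.P K) 1 → Matrix (Fin N) (Fin N) ℂ}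
    (hW : readField F N (suOfMat N) W ∈ U) :
    mergedTermFamilyMatT F N (TcanOfRecord F N) χ ε 0 v K W = ZeroInput.zeroInputMergedTermFamilyMatT F N (TcanOfRecord F N) χ ε 0 v K W :=
  dChannel_zero_at_first_level_fibrewise χ hε hK _ hUo hχU hreg h1 hW

end Summit.QuantumFields.YangMills.Theorems.PortZD

end
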